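import Summits.QuantumFields.YangMills.Theorems.BalabanUVNodesN15CurvedGluingCubeDefectGluing
import Summits.QuantumFields.YangMills.Theorems.BalabanUVNodesN15TwoSpacingGluingLocalityFar
import Summits.QuantumFields.YangMills.Theorems.BalabanUVNodesN15TwoSpacingGluingInputLocalized
import HarnessLib

/-!
# N15 = NE2, road (c) — PROGRAMME (PC), towards (PC-B): WALK LOCALITY OF FILE 32's GLUED OPERATOR WITH DEFECTS — two families of cube data `(Δ, G_□, E_□)`, `(Δ♭, G♭_□, E♭_□)` with FILE 32's
# rows (cut rows two-sided, commutator rows INPUT-localized, defect rows OUTPUT-localized) that are ε-CLOSE on the cubes NOT `Far` give glued operators differing by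
# `≤ [C_nearε + C_far·e^{−(δ∕4−σ)d_Z(y)}]·e^{−(δ∕4−2σ)d}` (dag-n15-c g27, n15-c∕291)

Cell `pub-ymgap`, seat `pub-ymgap-dag-n15-c` (generation g27; R134 (a), s1; HUMAN RULING D-0062).  `bears_on: R4∕N15 · K3⁸ SpineGivenEndpointR13SepCoPHV (stmt-QuantumFields-27366)`;
filed `--kind proof --supports stmt-QuantumFields-27366 --as helper` — COUNT-NEUTRAL.  Pure block-majorant algebra; 0 `def`, 0 `sorry`.  Imports FILE 32 `…CurvedGluingCubeDefectGluing`
(`hasMaj_remainderD`, `parametrix_cut`, `hasMaj_parametrix`), n15-c∕290 `…TwoSpacingGluingLocalityFar` (`hasMaj_glueInv_sub_glueInv_farW`, `hasMaj_farW_of_outLoc`; through it 279∕289),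
dag-n15-w4 `…TwoSpacingGluingInputLocalized` (`hasMaj_sum_overlap_in`).  Nothing in the tree is modified.

WHAT.  `hasMaj_sum_far_out` ∕ `hasMaj_sum_far_in` (sums of one-sided localized far pieces are localized on `Z` on that side); `parametrix_sub`, `remainderD_sub` (the differences as sums over
cubes); ★★★ `hasMaj_glued_sub_glued_of_cutRows_defect_close`: FILE 32's `hasMaj_glued_of_cutRows_defect` hypotheses for BOTH families (same partition `h`, cuts `χ`, reaches `S_□`, overlap
`N_ov`, `N_ov(θ₀ + ε)c_r < 1`) + on the cubes NOT `Far`: `M_χ(G_□ − G♭_□) ≤ 1_S1_S·ε_Ge^{−δd}`, `[Δ,M_h]G_□ − [Δ♭,M_h]G♭_□ ≤ 1_S(y′)·ε_Ke^{−δd}`, `E_□ − E♭_□ ≤ 1_S(y)·ε_Ee^{−δd}` + `S_□ ⊆ Z`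
on the far cubes, `8σ ≤ δ` ⟹ the two glued operators differ by `≤ [(N_ovε_G + N_ovβ·N_c·N_ov(ε_K+ε_E)·c_r)N_c + (2N_ovβ + N_ovβ·N_c·4N_ov(θ₀… )·c_r)N_c·e^{−(δ∕4−σ)d_Z(y)}]·e^{−(δ∕4−2σ)d}`.

HONEST FRAMING ∕ LIMITS.  Algebra of glued inverses; no propagator estimated; [B9] Cor. 3.8 ∕ Thm 3.14 cited for the MECHANISM.  NE2⁺ NOT PRINTED, NOT proved; N15 of record untouched;
K3⁸ OPEN; counts UNMOVED.  Restate-immune (no Theses import).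
-/

noncomputable section

open scoped BigOperators Matrix
open Finset

namespace Summit.QuantumFields.YangMills.BalabanUVNodes.N15.CurvedSpecies

open Literature.MathematicalPhysics.QuantumFieldTheory.Balaban1983to89
open Literature.MathematicalPhysics.QuantumFieldTheory.Balaban1983to89.B11SectG (BlockNorm HasMaj RowSum hasMaj_zero)
open Literature.MathematicalPhysics.QuantumFieldTheory.Balaban1983to89.B6RandomWalk (Triangle254)
open Literature.MathematicalPhysics.QuantumFieldTheory.Balaban1983to89.T4EtaRateCoeffDefect (diagK diagK_nonneg hasMaj_mulOp)
open Literature.MathematicalPhysics.QuantumFieldTheory.Balaban1983to89.B6Prop26Gluing (mulOp mulOp_apply ind ind_nonneg ind_le_one ind_of_mem ind_of_not_mem)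
open Summit.QuantumFields.YangMills.BalabanUVNodes.N15.Gluing (parametrix remainder commOp glueInv hasMaj_parametrix hasMaj_sum_overlap hasMaj_sum_overlap_in hasMaj_comp_diag
  hasMaj_mulOp_sandwich hasMaj_remainder_in parametrix_cut hasMaj_sum_far hasMaj_farW_of_outLoc hasMaj_glueInv_sub_glueInv_farW)

section Close

variable {X : Type} [Fintype X] [DecidableEq X] {ι : Type} [Fintype ι] {g : B6.Geometry} (blk : X → g.Site) (S : ι → Set g.Site) (Far : ι → Prop) [DecidablePred Far]
  (Z : Set g.Site) (dZ : g.Site → ℝ) {σ cr : ℝ}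

omit [DecidableEq X] in
/-- a sum of OUTPUT-localized far pieces is output-localized on `Z`: `Σ_□ D_□ ≤ 1_Z(y)·N_ov·c·e^{−δd}`. [folklore] -/
theorem hasMaj_sum_far_out {Nov : ℝ} (hN : ∀ a, ∑ i, ind (S i) a ≤ Nov) (hZ : ∀ i, Far i → S i ⊆ Z) {D : ι → (X → ℝ) →ₗ[ℝ] (X → ℝ)} {c δ : ℝ} (hc : 0 ≤ c)
    (hD : ∀ i, Far i → HasMaj (BlockNorm.ofBlocks g blk) (BlockNorm.ofBlocks g blk) (D i) (fun y y' => ind (S i) y * (c * Real.exp (-(δ * g.dist y y')))))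
    (hD0 : ∀ i, ¬Far i → D i = 0) :
    HasMaj (BlockNorm.ofBlocks g blk) (BlockNorm.ofBlocks g blk) (∑ i, D i) (fun y y' => ind Z y * (Nov * c * Real.exp (-(δ * g.dist y y')))) := by
  have hterm : ∀ i, HasMaj (BlockNorm.ofBlocks g blk) (BlockNorm.ofBlocks g blk) (D i) (fun y y' => ind (S i) y * (ind Z y * (c * Real.exp (-(δ * g.dist y y'))))) := by
    intro i
    by_cases hi : Far i
    · refine (hD i hi).mono fun y y' => ?_
      have hE : 0 ≤ c * Real.exp (-(δ * g.dist y y')) := mul_nonneg hc (Real.exp_nonneg _)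
      by_cases hy : y ∈ S i
      · rw [ind_of_mem hy, ind_of_mem (hZ i hi hy)]; simp only [one_mul]; exact le_rfl
      · rw [ind_of_not_mem hy, zero_mul, zero_mul]
    · rw [hD0 i hi]
      exact (hasMaj_zero _ _).mono fun y y' => mul_nonneg (ind_nonneg _ _) (mul_nonneg (ind_nonneg _ _) (mul_nonneg hc (Real.exp_nonneg _)))
  refine (hasMaj_sum_overlap _ S _ Nov (fun y y' => mul_nonneg (ind_nonneg _ _) (mul_nonneg hc (Real.exp_nonneg _))) hterm hN).mono fun y y' => le_of_eq ?_
  ring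

omit [DecidableEq X] in
/-- a sum of INPUT-localized far pieces is input-localized on `Z`: `Σ_□ D_□ ≤ 1_Z(y′)·N_ov·c·e^{−δd}`. [folklore] -/
theorem hasMaj_sum_far_in {Nov : ℝ} (hN : ∀ a, ∑ i, ind (S i) a ≤ Nov) (hZ : ∀ i, Far i → S i ⊆ Z) {D : ι → (X → ℝ) →ₗ[ℝ] (X → ℝ)} {c δ : ℝ} (hc : 0 ≤ c)
    (hD : ∀ i, Far i → HasMaj (BlockNorm.ofBlocks g blk) (BlockNorm.ofBlocks g blk) (D i) (fun y y' => ind (S i) y' * (c * Real.exp (-(δ * g.dist y y')))))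
    (hD0 : ∀ i, ¬Far i → D i = 0) :
    HasMaj (BlockNorm.ofBlocks g blk) (BlockNorm.ofBlocks g blk) (∑ i, D i) (fun y y' => ind Z y' * (Nov * c * Real.exp (-(δ * g.dist y y')))) := by
  have hterm : ∀ i, HasMaj (BlockNorm.ofBlocks g blk) (BlockNorm.ofBlocks g blk) (D i) (fun y y' => ind (S i) y' * (ind Z y' * (c * Real.exp (-(δ * g.dist y y'))))) := by
    intro i
    by_cases hi : Far i
    · refine (hD i hi).mono fun y y' => ?_
      by_cases hy : y' ∈ S i
      · rw [ind_of_mem hy, ind_of_mem (hZ i hi hy)]; simp only [one_mul]; exact le_rfl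
      · rw [ind_of_not_mem hy, zero_mul, zero_mul]
    · rw [hD0 i hi]
      exact (hasMaj_zero _ _).mono fun y y' => mul_nonneg (ind_nonneg _ _) (mul_nonneg (ind_nonneg _ _) (mul_nonneg hc (Real.exp_nonneg _)))
  refine (hasMaj_sum_overlap_in _ S _ Nov (fun y y' => mul_nonneg (ind_nonneg _ _) (mul_nonneg hc (Real.exp_nonneg _))) hterm hN).mono fun y y' => le_of_eq ?_
  ring

omit [Fintype X] [DecidableEq X] in
/-- the difference of two parametrices over the same partition is the parametrix of the difference family. [folklore] -/
theorem parametrix_sub (h : ι → X → ℝ) (G G' : ι → (X → ℝ) →ₗ[ℝ] (X → ℝ)) : parametrix h G - parametrix h G' = parametrix h (fun i => G i - G' i) := by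
  unfold parametrix
  rw [← Finset.sum_sub_distrib]
  exact Finset.sum_congr rfl fun i _ => by rw [LinearMap.sub_comp, LinearMap.comp_sub]

omit [Fintype X] [DecidableEq X] in
/-- the remainder with defects, as a sum over cubes. [folklore] -/
theorem remainderD_eq_sum (Δ : (X → ℝ) →ₗ[ℝ] (X → ℝ)) (h : ι → X → ℝ) (G E : ι → (X → ℝ) →ₗ[ℝ] (X → ℝ)) :
    remainder Δ h G - ∑ i, E i ∘ₗ mulOp (h i) = ∑ i, -((commOp Δ (h i) ∘ₗ G i + E i) ∘ₗ mulOp (h i)) := by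
  rw [remainder, ← Finset.sum_neg_distrib, ← Finset.sum_sub_distrib]
  exact Finset.sum_congr rfl fun i _ => by rw [LinearMap.add_comp, LinearMap.comp_assoc, neg_add, sub_eq_add_neg]

/-- ★★★ **WALK LOCALITY OF FILE 32's GLUED OPERATOR WITH DEFECTS, CLOSE NEAR DATA**: two families of cube data with FILE 32's rows over the SAME partition, cuts, reaches and overlap;
on the cubes not `Far` the cut cube operators, the commutator pieces and the defects are `ε_G`∕`ε_K`∕`ε_E`-close (in FILE 32's one-sided shapes), on the far cubes `S_□ ⊆ Z` ⟹
`𝒢 − 𝒢♭ ≤ [(N_ovε_G + (N_ovβ)N_c(N_ov(ε_K + ε_E))c_r)N_c + (2N_ovβ + (N_ovβ)N_c(2N_ovε + 2N_ovθ₀)c_r)N_c·e^{−(δ∕4−σ)d_Z(y)}]·e^{−(δ∕4−2σ)d}`, `N_c = (1 − N_ov(θ₀+ε)c_r)⁻¹c_r`.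
[cite: Balaban1985BackgroundPropagators, Cor. 3.8 (3.94) p.410, Thm 3.14 pp.426–427 (mechanism); Balaban1984PropagatorsII, (2.91) p.239, (2.133)–(2.136) p.247] -/
theorem hasMaj_glued_sub_glued_of_cutRows_defect_close (htri : Triangle254 g) (hd : ∀ a b : g.Site, 0 ≤ g.dist a b) (hd0 : ∀ y : g.Site, g.dist y y = 0) (hrow : RowSum g σ cr)
    (hσ : 0 ≤ σ) (hcr : 0 ≤ cr) (hdZ : ∀ y z, z ∈ Z → dZ y ≤ g.dist y z) (hdZ0 : ∀ y, 0 ≤ dZ y)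
    {Δ Δ' : (X → ℝ) →ₗ[ℝ] (X → ℝ)} {h χ : ι → X → ℝ} {G G' E E' : ι → (X → ℝ) →ₗ[ℝ] (X → ℝ)} {β θ₀ ε εG εK εE δ Nov : ℝ} (hβ : 0 ≤ β) (hθ : 0 ≤ θ₀) (hε : 0 ≤ ε)
    (hεG : 0 ≤ εG) (hεK : 0 ≤ εK) (hεE : 0 ≤ εE) (hNov : 0 ≤ Nov) (hσδ : 8 * σ ≤ δ) (hcut : ∀ i, mulOp (h i) ∘ₗ mulOp (χ i) = mulOp (h i)) (hh : ∀ i x, |h i x| ≤ 1)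
    (hN : ∀ a, ∑ i, ind (S i) a ≤ Nov) (hZ : ∀ i, Far i → S i ⊆ Z)
    (hGc : ∀ i, HasMaj (BlockNorm.ofBlocks g blk) (BlockNorm.ofBlocks g blk) (mulOp (χ i) ∘ₗ G i) (fun y y' => ind (S i) y * ind (S i) y' * (β * Real.exp (-(δ * g.dist y y')))))
    (hGc' : ∀ i, HasMaj (BlockNorm.ofBlocks g blk) (BlockNorm.ofBlocks g blk) (mulOp (χ i) ∘ₗ G' i) (fun y y' => ind (S i) y * ind (S i) y' * (β * Real.exp (-(δ * g.dist y y')))))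
    (hK : ∀ i, HasMaj (BlockNorm.ofBlocks g blk) (BlockNorm.ofBlocks g blk) (commOp Δ (h i) ∘ₗ G i) (fun y y' => ind (S i) y' * (θ₀ * Real.exp (-(δ * g.dist y y')))))
    (hK' : ∀ i, HasMaj (BlockNorm.ofBlocks g blk) (BlockNorm.ofBlocks g blk) (commOp Δ' (h i) ∘ₗ G' i) (fun y y' => ind (S i) y' * (θ₀ * Real.exp (-(δ * g.dist y y')))))
    (hE : ∀ i, HasMaj (BlockNorm.ofBlocks g blk) (BlockNorm.ofBlocks g blk) (E i) (fun y y' => ind (S i) y * (ε * Real.exp (-(δ * g.dist y y')))))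
    (hE' : ∀ i, HasMaj (BlockNorm.ofBlocks g blk) (BlockNorm.ofBlocks g blk) (E' i) (fun y y' => ind (S i) y * (ε * Real.exp (-(δ * g.dist y y')))))
    (hGG : ∀ i, ¬Far i → HasMaj (BlockNorm.ofBlocks g blk) (BlockNorm.ofBlocks g blk) (mulOp (χ i) ∘ₗ (G i - G' i))
      (fun y y' => ind (S i) y * ind (S i) y' * (εG * Real.exp (-(δ * g.dist y y')))))
    (hKK : ∀ i, ¬Far i → HasMaj (BlockNorm.ofBlocks g blk) (BlockNorm.ofBlocks g blk) (commOp Δ (h i) ∘ₗ G i - commOp Δ' (h i) ∘ₗ G' i)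
      (fun y y' => ind (S i) y' * (εK * Real.exp (-(δ * g.dist y y')))))
    (hEE : ∀ i, ¬Far i → HasMaj (BlockNorm.ofBlocks g blk) (BlockNorm.ofBlocks g blk) (E i - E' i) (fun y y' => ind (S i) y * (εE * Real.exp (-(δ * g.dist y y')))))
    (hq : Nov * (θ₀ + ε) * cr < 1) :
    HasMaj (BlockNorm.ofBlocks g blk) (BlockNorm.ofBlocks g blk)
      (glueInv (parametrix h G) (remainder Δ h G - ∑ i, E i ∘ₗ mulOp (h i)) - glueInv (parametrix h G') (remainder Δ' h G' - ∑ i, E' i ∘ₗ mulOp (h i)))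
      (fun y y' => ((Nov * εG + Nov * β * ((1 - Nov * (θ₀ + ε) * cr)⁻¹ * cr) * (Nov * (εK + εE)) * cr) * ((1 - Nov * (θ₀ + ε) * cr)⁻¹ * cr) +
          (Nov * (2 * β) + Nov * β * ((1 - Nov * (θ₀ + ε) * cr)⁻¹ * cr) * (Nov * (2 * ε) + Nov * (2 * θ₀)) * cr) * ((1 - Nov * (θ₀ + ε) * cr)⁻¹ * cr) *
            Real.exp (-((δ / 4 - σ) * dZ y))) * Real.exp (-((δ / 4 - 2 * σ) * g.dist y y'))) := by
  classical
  have hnn1 : ∀ {c : ℝ}, 0 ≤ c → ∀ (i : ι) (y y' : g.Site), 0 ≤ ind (S i) y * (c * Real.exp (-(δ * g.dist y y'))) := fun hc i y y' =>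
    mul_nonneg (ind_nonneg _ _) (mul_nonneg hc (Real.exp_nonneg _))
  have hnn1i : ∀ {c : ℝ}, 0 ≤ c → ∀ (i : ι) (y y' : g.Site), 0 ≤ ind (S i) y' * (c * Real.exp (-(δ * g.dist y y'))) := fun hc i y y' =>
    mul_nonneg (ind_nonneg _ _) (mul_nonneg hc (Real.exp_nonneg _))
  have hnn2 : ∀ {c : ℝ}, 0 ≤ c → ∀ (i : ι) (y y' : g.Site), 0 ≤ ind (S i) y * ind (S i) y' * (c * Real.exp (-(δ * g.dist y y'))) := fun hc i y y' =>
    mul_nonneg (mul_nonneg (ind_nonneg _ _) (ind_nonneg _ _)) (mul_nonneg hc (Real.exp_nonneg _))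
  -- the near ∕ far families
  set Gn : ι → (X → ℝ) →ₗ[ℝ] (X → ℝ) := fun i => if Far i then 0 else G i - G' i with hGn
  set Gf : ι → (X → ℝ) →ₗ[ℝ] (X → ℝ) := fun i => if Far i then G i - G' i else 0 with hGf
  set KnK : ι → (X → ℝ) →ₗ[ℝ] (X → ℝ) := fun i => if Far i then 0 else -((commOp Δ (h i) ∘ₗ G i - commOp Δ' (h i) ∘ₗ G' i) ∘ₗ mulOp (h i)) with hKnK
  set KnE : ι → (X → ℝ) →ₗ[ℝ] (X → ℝ) := fun i => if Far i then 0 else -((E i - E' i) ∘ₗ mulOp (h i)) with hKnE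
  set Ko : ι → (X → ℝ) →ₗ[ℝ] (X → ℝ) := fun i => if Far i then -((E i - E' i) ∘ₗ mulOp (h i)) else 0 with hKo
  set Ki : ι → (X → ℝ) →ₗ[ℝ] (X → ℝ) := fun i => if Far i then -((commOp Δ (h i) ∘ₗ G i - commOp Δ' (h i) ∘ₗ G' i) ∘ₗ mulOp (h i)) else 0 with hKi
  -- the two splits
  have hsplitP : parametrix h G - parametrix h G' = parametrix h Gn + parametrix h Gf := by
    rw [parametrix_sub]
    unfold parametrix
    rw [← Finset.sum_add_distrib]
    refine Finset.sum_congr rfl fun i _ => ?_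
    simp only [hGn, hGf]
    split_ifs <;> simp
  have hsplitR : (remainder Δ h G - ∑ i, E i ∘ₗ mulOp (h i)) - (remainder Δ' h G' - ∑ i, E' i ∘ₗ mulOp (h i)) =
      (∑ i, KnK i + ∑ i, KnE i) + (∑ i, Ko i + ∑ i, Ki i) := by
    rw [remainderD_eq_sum, remainderD_eq_sum, ← Finset.sum_sub_distrib, ← Finset.sum_add_distrib, ← Finset.sum_add_distrib, ← Finset.sum_add_distrib]
    refine Finset.sum_congr rfl fun i _ => ?_
    simp only [hKnK, hKnE, hKo, hKi]
    split_ifs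
    · simp only [zero_add, LinearMap.sub_comp, LinearMap.add_comp]; abel
    · simp only [add_zero, LinearMap.sub_comp, LinearMap.add_comp]; abel
  -- rows of the primed pair
  have hP' : HasMaj (BlockNorm.ofBlocks g blk) (BlockNorm.ofBlocks g blk) (parametrix h G') (fun y y' => Nov * β * Real.exp (-(δ * g.dist y y'))) := by
    rw [← parametrix_cut hcut]; exact hasMaj_parametrix blk S hβ hh hN hGc'
  have hR := hasMaj_remainderD blk S hθ hε hh hN hK hE
  have hR' := hasMaj_remainderD blk S hθ hε hh hN hK' hE'
  have hMb : ∀ i, HasMaj (BlockNorm.ofBlocks g blk) (BlockNorm.ofBlocks g blk) (mulOp (h i)) (diagK fun _ => (1 : ℝ)) := fun i =>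
    hasMaj_mulOp (g := g) blk (m := fun _ => (1 : ℝ)) (fun _ => zero_le_one) (hh i)
  -- near parts: plain small rows
  have hDn : HasMaj (BlockNorm.ofBlocks g blk) (BlockNorm.ofBlocks g blk) (parametrix h Gn) (fun y y' => Nov * εG * Real.exp (-(δ * g.dist y y'))) := by
    rw [← parametrix_cut hcut]
    refine hasMaj_parametrix blk S hεG hh hN fun i => ?_
    by_cases hi : Far i
    · simp only [hGn, if_pos hi, LinearMap.comp_zero]; exact (hasMaj_zero _ _).mono (hnn2 hεG i)
    · simp only [hGn, if_neg hi]; exact hGG i hi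
  have hEnK : HasMaj (BlockNorm.ofBlocks g blk) (BlockNorm.ofBlocks g blk) (∑ i, KnK i) (fun y y' => Nov * (εK * Real.exp (-(δ * g.dist y y')))) := by
    refine hasMaj_sum_overlap_in (b₁ := BlockNorm.ofBlocks g blk) (b₃ := BlockNorm.ofBlocks g blk) _ S _ Nov (fun y y' => mul_nonneg hεK (Real.exp_nonneg _)) (fun i => ?_) hN
    by_cases hi : Far i
    · simp only [hKnK, if_pos hi]; exact (hasMaj_zero _ _).mono (hnn1i hεK i)
    · simp only [hKnK, if_neg hi]; exact ((hasMaj_comp_diag blk (hnn1i hεK i) (hKK i hi) (hMb i)).neg).mono fun y y' => le_of_eq (by ring)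
  have hEnE : HasMaj (BlockNorm.ofBlocks g blk) (BlockNorm.ofBlocks g blk) (∑ i, KnE i) (fun y y' => Nov * (εE * Real.exp (-(δ * g.dist y y')))) := by
    refine hasMaj_sum_overlap (b₁ := BlockNorm.ofBlocks g blk) (b₃ := BlockNorm.ofBlocks g blk) _ S _ Nov (fun y y' => mul_nonneg hεE (Real.exp_nonneg _)) (fun i => ?_) hN
    by_cases hi : Far i
    · simp only [hKnE, if_pos hi]; exact (hasMaj_zero _ _).mono (hnn1 hεE i)
    · simp only [hKnE, if_neg hi]; exact ((hasMaj_comp_diag blk (hnn1 hεE i) (hEE i hi) (hMb i)).neg).mono fun y y' => le_of_eq (by ring)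
  have hEn : HasMaj (BlockNorm.ofBlocks g blk) (BlockNorm.ofBlocks g blk) (∑ i, KnK i + ∑ i, KnE i) (fun y y' => Nov * (εK + εE) * Real.exp (-(δ * g.dist y y'))) :=
    (hEnK.add hEnE).mono fun y y' => le_of_eq (by ring)
  -- far parts: the parametrix part two-sided (hence output-localized, hence far-weighted), the defects output-localized, the commutators input-localized
  have hDf0 : HasMaj (BlockNorm.ofBlocks g blk) (BlockNorm.ofBlocks g blk) (parametrix h Gf) (fun y y' => ind Z y * (Nov * (2 * β) * Real.exp (-(δ * g.dist y y')))) := by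
    rw [← parametrix_cut hcut]
    refine hasMaj_sum_far blk S Far Z hN hZ (D := fun i => mulOp (h i) ∘ₗ (mulOp (χ i) ∘ₗ Gf i) ∘ₗ mulOp (h i)) (c := 2 * β) (δ := δ) (by positivity) (fun i => ?_) (fun i hi => ?_)
    · by_cases hi : Far i
      · simp only [hGf, if_pos hi, LinearMap.comp_sub]
        exact hasMaj_mulOp_sandwich blk (hnn2 (c := 2 * β) (by positivity) i) (hh i) (hh i) (((hGc i).sub (hGc' i)).mono fun y y' => le_of_eq (by ring))
      · simp only [hGf, if_neg hi, LinearMap.comp_zero, LinearMap.zero_comp]; exact (hasMaj_zero _ _).mono (hnn2 (c := 2 * β) (by positivity) i)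
    · simp only [hGf, if_neg hi, LinearMap.comp_zero, LinearMap.zero_comp]
  have hDf : HasMaj (BlockNorm.ofBlocks g blk) (BlockNorm.ofBlocks g blk) (parametrix h Gf)
      (fun y y' => Real.exp (-(δ / 2 * dZ y)) * (Nov * (2 * β) * Real.exp (-(δ / 2 * g.dist y y')))) :=
    (hasMaj_farW_of_outLoc Z dZ hd0 hdZ (by positivity) (by linarith : (0 : ℝ) ≤ δ / 2) hDf0).mono fun y y' =>
      mul_le_mul_of_nonneg_left (mul_le_mul_of_nonneg_left (Real.exp_le_exp.mpr (by nlinarith [hd y y'])) (by positivity)) (Real.exp_nonneg _)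
  have hEo : HasMaj (BlockNorm.ofBlocks g blk) (BlockNorm.ofBlocks g blk) (∑ i, Ko i) (fun y y' => ind Z y * (Nov * (2 * ε) * Real.exp (-(δ * g.dist y y')))) := by
    refine hasMaj_sum_far_out blk S Far Z hN hZ (by positivity) (fun i hi => ?_) (fun i hi => by simp only [hKo, if_neg hi])
    simp only [hKo, if_pos hi]
    exact ((hasMaj_comp_diag blk (hnn1 (c := 2 * ε) (by positivity) i) (((hE i).sub (hE' i)).mono fun y y' => le_of_eq (by ring)) (hMb i)).neg).mono fun y y' => le_of_eq (by ring)
  have hEi : HasMaj (BlockNorm.ofBlocks g blk) (BlockNorm.ofBlocks g blk) (∑ i, Ki i) (fun y y' => ind Z y' * (Nov * (2 * θ₀) * Real.exp (-(δ * g.dist y y')))) := by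
    refine hasMaj_sum_far_in blk S Far Z hN hZ (by positivity) (fun i hi => ?_) (fun i hi => by simp only [hKi, if_neg hi])
    simp only [hKi, if_pos hi]
    exact ((hasMaj_comp_diag blk (hnn1i (c := 2 * θ₀) (by positivity) i) (((hK i).sub (hK' i)).mono fun y y' => le_of_eq (by ring)) (hMb i)).neg).mono fun y y' => le_of_eq (by ring)
  exact hasMaj_glueInv_sub_glueInv_farW blk Z dZ htri hd hd0 hrow hσ hcr hdZ hdZ0 (mul_nonneg hNov hβ) (mul_nonneg hNov (add_nonneg hθ hε)) (mul_nonneg hNov hεG) (by positivity)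
    (by positivity) (by positivity) (by positivity) hσδ hsplitP hsplitR hP' hR hR' hDn hEn hDf hEo hEi hq

end Close

end Summit.QuantumFields.YangMills.BalabanUVNodes.N15.CurvedSpecies

end
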